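import Summits.FinalStateConjecture.FinalStateConjecture.Theorems.DrainImpliesDisperse.Negative.DrainImpliesDisperseFalseOfFramedPulsedObserver
import Literature.Geometry.Lorentzian.TimeCones
import HarnessLib

/-!
# Crux `DrainImpliesDisperse` (stmt-FinalStateConjecture-17283), negative side, AXIS FORM:
# the observer of the framed pulsed witness IS the frame's time axis

`Negative.DrainImpliesDisperse_false_of_framedPulsedObserverDevelopmentExists` refutes the crux as filed
modulo `H'' = FramedPulsedObserverDevelopmentExists`: a drained censored MGHD of an admissible datum with a
global near-Minkowski frame `(Θ, Ξ)` and an abstract observer `c` which is (T) future timelike, (R)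
ray-borne, (V) all-seeing and (W) recurrently pulsed. In a framed spacetime the natural observer is the
frame's time axis `s ↦ Θ(s ∂₀)`, and for it (T) and (V) are THEOREMS of the frame:

* `isFutureTimelikeCurveOn_axis` — the axis is a future timelike curve (its velocity is `Θ_* ∂₀`,
  timelike by pinching and future-directed by orientation);
* `axis_mem_chronologicalFuture` — EVERY event `a` is chronologically seen by the axis: with
  `z = Ξ a`, the frame segment from `z` to `s ∂₀`, `s = z⁰ + 2‖z̲‖ + 1`, has direction `u` with
  `‖u̲‖ ≤ u⁰/2`, which is `Θ^*g`-timelike and future-directed for every `‖Θ^*g − η‖ < 1/4`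
  (`isTimelike_and_isFutureDirected_mfderiv_frame`), so `a = Θ z ≪ Θ(s ∂₀)`.

Hence the construction hypothesis shrinks to `H''' = FramedAxisPulsesDevelopmentExists`: a drained censored
MGHD of an admissible datum with a global near-Minkowski frame (pinched, future-oriented, frame time `≥ 0`
on `J⁺(ι X)`) whose time axis is (R) ray-borne at parameters `≥ 0` and (W) recurrently `C²`-pulsed with
a frame-independent floor `δ > 0` — `H''' → H''` (`framedPulsedObserverDevelopmentExists_of_axis`) and
`DrainImpliesDisperse_false_of_framedAxisPulsesDevelopmentExists`. For the maximal development of the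
ripple datum `δ + ε r⁻¹⁰ sin(r⁴) w₀` (`Cruxes/DrainImpliesDisperse/REPORT-c3.md` §§2–3, REPORT-c5.md) the axis
is the central worldline on which the focused tidal pulses recur. Not constructible in the tree (no
maximal development of a non-flat admissible datum). Line lead
`prover-line-stmt-FinalStateConjecture-17283-c5-0`, 2026-08-17.
-/

noncomputable section

set_option linter.dupNamespace false -- D-0017: `Summit.<S>.<S>.…` by design

open Set Filter Function TopologicalSpace Topology
open scoped Manifold ContDiff Topology

namespace Summit.FinalStateConjecture.FinalStateConjecture.Theorems.DrainImpliesDisperse.Negative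

open Literature.Geometry.Lorentzian
open Summit.FinalStateConjecture (HasCompleteNullInfinity)
open Summit.FinalStateConjecture.FinalStateConjecture.Theses.BondiDrainDispersal (DrainImpliesDisperse)

/-! ### Frame segments `t ↦ Θ(z + t u)` -/

section Segment

variable {𝓢 : Spacetime 4} {Θ : Minkowski.background.domain → 𝓢.carrier}

/-- Chain rule for velocities: `(f ∘ γ)'(t) = df_{γ t}(γ' t)`. [folklore] -/
private theorem velocity_comp'' {E' : Type*} [NormedAddCommGroup E'] [NormedSpace ℝ E']
    {H' : Type*} [TopologicalSpace H'] {I' : ModelWithCorners ℝ E' H'} {N : Type*}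
    [TopologicalSpace N] [ChartedSpace H' N]
    {E : Type*} [NormedAddCommGroup E] [NormedSpace ℝ E] {H : Type*} [TopologicalSpace H]
    {I : ModelWithCorners ℝ E H} {M : Type*} [TopologicalSpace M] [ChartedSpace H M]
    {f : N → M} {γ : ℝ → N} {t : ℝ} (hf : MDifferentiableAt I' I f (γ t))
    (hγ : MDifferentiableAt 𝓘(ℝ, ℝ) I' γ t) :
    velocity I (f ∘ γ) t = mfderiv I' I f (γ t) (velocity I' γ t) := by
  simp only [velocity]
  rw [mfderiv_comp t hf hγ]
  rfl

/-- **The lifted frame segment and its velocity**: for smooth `Θ : E4 → M` and a curve `c` of the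
(full) background domain whose underlying `E4`-curve is the segment `s ↦ z + s u`, the lift `Θ ∘ c` is
differentiable with velocity `dΘ_{c t}(u)` (chain rule; the inclusion has identity differential).
[folklore] -/
theorem segment_lift (hΘ : ContMDiff 𝓘(ℝ, E4) (𝓡 4) ∞ Θ) (z u : E4)
    {c : ℝ → Minkowski.background.domain} (hc : ∀ s : ℝ, (c s : E4) = z + s • u) (t : ℝ) :
    MDifferentiableAt 𝓘(ℝ, ℝ) (𝓡 4) (Θ ∘ c) t ∧
      velocity (𝓡 4) (Θ ∘ c) t = mfderiv 𝓘(ℝ, E4) (𝓡 4) Θ (c t) u := by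
  have hline : ∀ s : ℝ, HasDerivAt (fun s : ℝ ↦ z + s • u) u s := fun s ↦ by
    simpa using ((hasDerivAt_id s).smul_const u).const_add z
  have hcv : Subtype.val ∘ c = fun s : ℝ ↦ z + s • u := funext hc
  have hp_smooth : ContMDiff 𝓘(ℝ, ℝ) 𝓘(ℝ, E4) ∞ (fun s : ℝ ↦ z + s • u) :=
    contMDiff_iff_contDiff.mpr (contDiff_const.add (contDiff_id.smul contDiff_const))
  have hc_smooth : ContMDiff 𝓘(ℝ, ℝ) 𝓘(ℝ, E4) ∞ c :=
    (ContMDiff.subtypeVal_comp_iff _ c).mp (hcv ▸ hp_smooth)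
  have hct : MDifferentiableAt 𝓘(ℝ, ℝ) 𝓘(ℝ, E4) c t := hc_smooth.mdifferentiableAt (by simp)
  have hΘt : MDifferentiableAt 𝓘(ℝ, E4) (𝓡 4) Θ (c t) := hΘ.mdifferentiableAt (by simp)
  refine ⟨hΘt.comp t hct, ?_⟩
  have hvc : velocity 𝓘(ℝ, E4) c t = u := by
    have h1 : velocity 𝓘(ℝ, E4) (Subtype.val ∘ c) t =
        mfderiv 𝓘(ℝ, E4) 𝓘(ℝ, E4) (Subtype.val : Minkowski.background.domain → E4) (c t)
          (velocity 𝓘(ℝ, E4) c t) :=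
      velocity_comp'' (hasMFDerivAt_subtypeVal (c t)).mdifferentiableAt hct
    rw [mfderiv_subtypeVal, hcv] at h1
    have h2 : velocity 𝓘(ℝ, E4) (fun s : ℝ ↦ z + s • u) t = u := by
      simp only [velocity]
      rw [mfderiv_eq_fderiv, ← toSpanSingleton_deriv, (hline t).deriv]
      exact one_smul ℝ _
    rw [h2] at h1
    exact h1.symm
  rw [velocity_comp'' hΘt hct, hvc]

end Segment

/-! ### Timelike frame directions -/

section Frame

variable (𝓢 : Spacetime 4) (Θ : Minkowski.background.domain → 𝓢.carrier)
  (hpinΘ : ∀ x, ‖𝓢.deviation Minkowski.background Θ x‖ < 1 / 4)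
  (hfutΘ : ∀ x, 𝓢.timeOrientation.IsFutureDirected
    (mfderiv 𝓘(ℝ, E4) (𝓡 4) Θ x (E4.basisVector 0)))

include hpinΘ hfutΘ in
/-- **Frame directions inside the half-aperture cone are future timelike**: if `u⁰ > 0` and
`‖u̲‖ ≤ u⁰/2` then `dΘ_x(u)` is timelike and future-directed, for every pinched future-oriented frame
(`(Θ^*g)(u,u) ≤ (5/4)‖u̲‖² − (3/4)(u⁰)² < 0`; `(Θ^*g)(∂₀, u) = −u⁰ + O(‖u‖/4) < 0` and the timecone
lemma). O'Neill 1983, Ch. 5, Lemma 5.26 and 5.29. [cite: ONeillSemiRiemannian1983, Ch. 5, Lemma 5.26] -/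
theorem isTimelike_and_isFutureDirected_mfderiv_frame (x : Minkowski.background.domain) (u : E4)
    (hu0 : 0 < u 0) (hu : ‖E4.spatial u‖ ≤ u 0 / 2) :
    𝓢.metric.IsTimelike (mfderiv 𝓘(ℝ, E4) (𝓡 4) Θ x u) ∧
      𝓢.timeOrientation.IsFutureDirected (mfderiv 𝓘(ℝ, E4) (𝓡 4) Θ x u) := by
  set G : E4 →L[ℝ] E4 →L[ℝ] ℝ := 𝓢.deviation Minkowski.background Θ x + Minkowski.bilin with hG
  have hGn : ‖G - Minkowski.bilin‖ < 1 / 4 := by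
    have heq : G - Minkowski.bilin = 𝓢.deviation Minkowski.background Θ x := by
      rw [hG]; exact add_sub_cancel_right (𝓢.deviation Minkowski.background Θ x) Minkowski.bilin
    rw [heq]; exact hpinΘ x
  have hGapp : ∀ v w : E4, G v w = 𝓢.metric.val (Θ x) (mfderiv 𝓘(ℝ, E4) (𝓡 4) Θ x v)
      (mfderiv 𝓘(ℝ, E4) (𝓡 4) Θ x w) := by
    intro v w
    show 𝓢.deviation Minkowski.background Θ x v w + Minkowski.bilin v w = _
    rw [Spacetime.deviation_apply]
    exact sub_add_cancel _ _
  -- timelike: `G(u, u) ≤ (5/4)‖u̲‖² − (3/4)(u⁰)² < 0`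
  have hup := (FramedProper.pinched_self_bounds hGn u).2
  have htl : G u u < 0 := by nlinarith [norm_nonneg (E4.spatial u)]
  have htl' : 𝓢.metric.IsTimelike (mfderiv 𝓘(ℝ, E4) (𝓡 4) Θ x u) := by
    show 𝓢.metric.val (Θ x) _ _ < 0
    rw [← hGapp]; exact htl
  refine ⟨htl', ?_⟩
  -- future: `g(Θ_*∂₀, Θ_*u) = G(∂₀, u) = −u⁰ + dev(∂₀, u) < 0`
  set h : E4 →L[ℝ] E4 →L[ℝ] ℝ := G - Minkowski.bilin with hh
  have hGe : G (E4.basisVector 0) u = -(u 0) + h (E4.basisVector 0) u := by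
    have h1 : Minkowski.bilin (E4.basisVector 0) u = -(u 0) := by
      rw [Minkowski.bilin_apply]; simp [E4.basisVector, Fin.succ_ne_zero]
    rw [hh]
    show G (E4.basisVector 0) u = -(u 0) + (G (E4.basisVector 0) u - Minkowski.bilin (E4.basisVector 0) u)
    rw [h1]; ring
  have hb := h.le_opNorm₂ (E4.basisVector 0) u
  have hne : ‖(E4.basisVector 0 : E4)‖ = 1 := by simp [E4.basisVector]
  rw [Real.norm_eq_abs, hne, mul_one] at hb
  have hnu : ‖u‖ ≤ |u 0| + ‖E4.spatial u‖ := by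
    have h := CoordSlice.norm_sq_eq u
    have h0 : 0 ≤ |u 0| + ‖E4.spatial u‖ := by positivity
    have h1 : ‖u‖ ^ 2 ≤ (|u 0| + ‖E4.spatial u‖) ^ 2 := by
      rw [h, add_sq, sq_abs]
      nlinarith [abs_nonneg (u 0), norm_nonneg (E4.spatial u)]
    exact (pow_le_pow_iff_left₀ (norm_nonneg _) h0 two_ne_zero).1 h1
  have hh0 : 0 ≤ ‖h‖ := norm_nonneg h
  have hval : G (E4.basisVector 0) u < 0 := by
    rw [hGe]
    have h1 : |h (E4.basisVector 0) u| ≤ 1 / 4 * ‖u‖ := hb.trans (by gcongr)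
    have h2 : h (E4.basisVector 0) u ≤ 1 / 4 * ‖u‖ := (le_abs_self _).trans h1
    rw [abs_of_pos hu0] at hnu
    nlinarith
  have he0t : 𝓢.metric.IsTimelike (mfderiv 𝓘(ℝ, E4) (𝓡 4) Θ x (E4.basisVector 0)) := by
    show 𝓢.metric.val (Θ x) _ _ < 0
    rw [← hGapp]
    exact Minkowski.apply_basisVector_zero_neg_of_norm_sub_bilin_lt_one (hGn.trans (by norm_num))
  have hcausal : 𝓢.metric.IsCausal (mfderiv 𝓘(ℝ, E4) (𝓡 4) Θ x u) := by
    refine ⟨le_of_lt htl', fun h0 ↦ ?_⟩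
    have : 𝓢.metric.val (Θ x) (mfderiv 𝓘(ℝ, E4) (𝓡 4) Θ x u) (mfderiv 𝓘(ℝ, E4) (𝓡 4) Θ x u) = 0 := by
      rw [h0]; simp
    exact absurd this (ne_of_lt htl')
  refine (TimeOrientation.isFutureDirected_iff_val_neg 𝓢.timeOrientation (hfutΘ x) he0t hcausal).2 ?_
  rw [← hGapp]; exact hval

end Frame

/-! ### The frame's time axis: future timelike and all-seeing -/

section Axis

variable (𝓢 : Spacetime 4) (Θ : Minkowski.background.domain → 𝓢.carrier) (Ξ : 𝓢.carrier → E4)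
  (hΘ : ContMDiff 𝓘(ℝ, E4) (𝓡 4) ∞ Θ)
  (hΘΞ : ∀ p, Θ ⟨Ξ p, Opens.mem_top _⟩ = p)
  (hpinΘ : ∀ x, ‖𝓢.deviation Minkowski.background Θ x‖ < 1 / 4)
  (hfutΘ : ∀ x, 𝓢.timeOrientation.IsFutureDirected
    (mfderiv 𝓘(ℝ, E4) (𝓡 4) Θ x (E4.basisVector 0)))

include hΘ hpinΘ hfutΘ in
/-- **The time axis `s ↦ Θ(s ∂₀)` of a pinched future-oriented frame is a future timelike curve.**
[folklore] -/
theorem isFutureTimelikeCurveOn_axis (S : Set ℝ) :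
    𝓢.metric.IsFutureTimelikeCurveOn 𝓢.timeOrientation
      (fun s : ℝ ↦ Θ ⟨s • E4.basisVector 0, trivial⟩) S := by
  intro s _
  obtain ⟨hd, hv⟩ := segment_lift (Θ := Θ) hΘ 0 (E4.basisVector 0)
    (c := fun s : ℝ ↦ (⟨s • E4.basisVector 0, trivial⟩ : Minkowski.background.domain))
    (fun s ↦ (zero_add _).symm) s
  have h := isTimelike_and_isFutureDirected_mfderiv_frame 𝓢 Θ hpinΘ hfutΘ
    ⟨s • E4.basisVector 0, trivial⟩ (E4.basisVector 0) (by simp [E4.basisVector])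
    (by
      have : E4.spatial (E4.basisVector 0 : E4) = 0 := by
        ext i; simp [E4.basisVector, Fin.succ_ne_zero]
      rw [this, norm_zero]; simp [E4.basisVector])
  exact ⟨hd, hv ▸ h.1, hv ▸ h.2⟩

include hΘ hΘΞ hpinΘ hfutΘ in
/-- **The time axis of a pinched future-oriented frame sees every event**: with `z = Ξ a` and
`s = z⁰ + 2‖z̲‖ + 1`, `a ≪ Θ(s ∂₀)` along the frame segment from `z` to `s ∂₀`. O'Neill 1983, Ch. 14,
p. 402. [cite: ONeillSemiRiemannian1983, Ch. 14, p. 402] -/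
theorem axis_mem_chronologicalFuture (a : 𝓢.carrier) :
    Θ ⟨(E4.time (Ξ a) + 2 * ‖E4.spatial (Ξ a)‖ + 1) • E4.basisVector 0, trivial⟩ ∈
      𝓢.metric.chronologicalFuture 𝓢.timeOrientation {a} := by
  set z : E4 := Ξ a with hz
  set s : ℝ := E4.time z + 2 * ‖E4.spatial z‖ + 1 with hs
  set u : E4 := s • E4.basisVector 0 - z with hu
  -- the direction `u` lies in the half-aperture cone
  have hsp0 : E4.spatial (E4.basisVector 0 : E4) = 0 := by
    ext i; simp [E4.basisVector, Fin.succ_ne_zero]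
  have hu0 : u 0 = 2 * ‖E4.spatial z‖ + 1 := by
    rw [hu, hs]
    simp only [E4.time_apply, PiLp.sub_apply, PiLp.smul_apply, smul_eq_mul]
    simp [E4.basisVector]
    ring
  have husp : E4.spatial u = -E4.spatial z := by
    rw [hu, map_sub, map_smul, hsp0, smul_zero, zero_sub]
  have hu0pos : 0 < u 0 := by rw [hu0]; positivity
  have hucone : ‖E4.spatial u‖ ≤ u 0 / 2 := by
    rw [husp, norm_neg, hu0]; linarith [norm_nonneg (E4.spatial z)]
  -- the lifted segment is future timelike on `[0, 1]`
  set γ : ℝ → 𝓢.carrier :=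
    Θ ∘ fun t : ℝ ↦ (⟨z + t • u, trivial⟩ : Minkowski.background.domain) with hγ
  have hcurve : 𝓢.metric.IsFutureTimelikeCurveOn 𝓢.timeOrientation γ (Icc 0 1) := by
    intro t _
    obtain ⟨hd, hv⟩ := segment_lift (Θ := Θ) hΘ z u
      (c := fun t : ℝ ↦ (⟨z + t • u, trivial⟩ : Minkowski.background.domain)) (fun _ ↦ rfl) t
    have h := isTimelike_and_isFutureDirected_mfderiv_frame 𝓢 Θ hpinΘ hfutΘ ⟨z + t • u, trivial⟩ u
      hu0pos hucone
    exact ⟨hd, hv ▸ h.1, hv ▸ h.2⟩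
  have h := mem_chronologicalFuture_of_timelikeCurve one_pos hcurve
  have hγ0 : γ 0 = a := by
    show Θ ⟨z + (0 : ℝ) • u, trivial⟩ = a
    have : (⟨z + (0 : ℝ) • u, trivial⟩ : Minkowski.background.domain) = ⟨Ξ a, Opens.mem_top _⟩ :=
      Subtype.ext (by simp [hz])
    rw [this]; exact hΘΞ a
  have hγ1 : γ 1 = Θ ⟨s • E4.basisVector 0, trivial⟩ := by
    show Θ ⟨z + (1 : ℝ) • u, trivial⟩ = _
    have : (⟨z + (1 : ℝ) • u, trivial⟩ : Minkowski.background.domain) = ⟨s • E4.basisVector 0, trivial⟩ :=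
      Subtype.ext (by simp [hu])
    rw [this]
  rw [hγ0, hγ1] at h
  exact h

end Axis

/-! ### The axis form of the construction hypothesis -/

/-- **Construction hypothesis `H'''` (axis form): a drained censored development with a global
near-Minkowski frame whose TIME AXIS is ray-borne and recurrently pulsed.** Some admissible datum has a
maximal vacuum Cauchy development `𝒟` with complete future null infinity (sojourn form) and vanishing
final Bondi mass, with smooth `Θ : E4 → M`, `Ξ : M → E4`, `Θ (Ξ p) = p`, `Θ` `C⁰`-pinched
(`‖(Θ^* g − η)(x)‖ < 1/4`) and future-oriented, frame time `(Ξ a)⁰ ≥ 0` on `J⁺(ι X)`, and a floor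
`0 < δ` such that: (R) every axis event `Θ(s ∂₀)`, `s ≥ 0`, lies on a future-complete normalised null ray
from the data at a parameter `≥ 0`; (W) for every `s₀` there is `s > s₀` at which no local chart of the
flat background through `Θ(s ∂₀)` is `δ`-quiet in `C²`. (T) and (V) of `H''` are theorems of the frame
(`isFutureTimelikeCurveOn_axis`, `axis_mem_chronologicalFuture`). Expected on paper for the maximal
development of the ripple datum `δ + ε r⁻¹⁰ sin(r⁴) w₀` with the central worldline as axis
(`Cruxes/DrainImpliesDisperse/REPORT-c3.md`, REPORT-c5.md); NOT constructible in the tree (no maximal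
development of a non-flat admissible datum). Construction hypothesis of a negative lemma, not a
published fact (no citation tag). -/
def FramedAxisPulsesDevelopmentExists : Prop :=
  ∃ (X : Type) (_ : TopologicalSpace X) (_ : ChartedSpace E3 X) (_ : IsManifold (𝓡 3) ∞ X)
    (_ : T2Space X) (_ : SecondCountableTopology X) (_ : ConnectedSpace X)
    (D : InitialDataSet (𝓡 3) X) (_ : D ∈ admissibleVacuumData X) (𝒟 : VacuumCauchyDevelopment D)
    (_ : 𝒟.IsMaximal) (_ : HasCompleteNullInfinity 𝒟.toCauchyDevelopment)
    (_ : 𝒟.toCauchyDevelopment.HasVanishingFinalBondiMass)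
    (Θ : Minkowski.background.domain → 𝒟.carrier) (Ξ : 𝒟.carrier → E4) (δ : ENNReal),
    ContMDiff 𝓘(ℝ, E4) (𝓡 4) ∞ Θ ∧ ContMDiff (𝓡 4) 𝓘(ℝ, E4) ∞ Ξ ∧
    (∀ p, Θ ⟨Ξ p, Opens.mem_top _⟩ = p) ∧
    (∀ x, ‖𝒟.toSpacetime.deviation Minkowski.background Θ x‖ < 1 / 4) ∧
    (∀ x, 𝒟.timeOrientation.IsFutureDirected (mfderiv 𝓘(ℝ, E4) (𝓡 4) Θ x (E4.basisVector 0))) ∧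
    (∀ a ∈ 𝒟.metric.causalFuture 𝒟.timeOrientation (range 𝒟.embed), 0 ≤ E4.time (Ξ a)) ∧
    0 < δ ∧
    (∀ [𝒟.metric.HasLeviCivita], ∀ s : ℝ, 0 ≤ s →
      ∃ (p : X) (γ : ℝ → 𝒟.carrier) (dom : Set ℝ) (t : ℝ),
        𝒟.metric.IsNormalisedNullRayFrom 𝒟.timeOrientation 𝒟.embed 𝒟.normal p γ dom ∧
          ¬ BddAbove dom ∧ t ∈ dom ∧ 0 ≤ t ∧ γ t = Θ ⟨s • E4.basisVector 0, trivial⟩) ∧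
    (∀ s₀ : ℝ, ∃ s : ℝ, s₀ < s ∧
      ∀ (U : Opens E4) (Φ : (Minkowski.backgroundOn U).domain → 𝒟.carrier)
        (V : Set (Minkowski.backgroundOn U).domain) (x : (Minkowski.backgroundOn U).domain),
        IsOpen V → x ∈ V → ContMDiff 𝓘(ℝ, E4) (𝓡 4) ∞ Φ → IsOpenEmbedding (V.restrict Φ) →
        Φ x = Θ ⟨s • E4.basisVector 0, trivial⟩ →
        δ ≤ supCkENorm {(x : E4)} 2 (𝒟.toSpacetime.deviationExtend (Minkowski.backgroundOn U) Φ))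

/-- **`H'''` implies `H''`**: take the frame's time axis as the observer; (T) and (V) are supplied by
`isFutureTimelikeCurveOn_axis` and `axis_mem_chronologicalFuture` (the parameter
`s = (Ξ a)⁰ + 2‖(Ξ a)̲‖ + 1` is `≥ 0` on `J⁺(ι X)` by the frame-time floor). [folklore] -/
theorem framedPulsedObserverDevelopmentExists_of_axis (H : FramedAxisPulsesDevelopmentExists) :
    FramedPulsedObserverDevelopmentExists := by
  obtain ⟨X, _, _, _, _, _, _, D, hD, 𝒟, hmax, hcni, hdrain, Θ, Ξ, δ, hΘ, hΞ, hΘΞ, hpinΘ, hfutΘ,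
    hfloor, hδ, hray, hwild⟩ := H
  refine ⟨X, inferInstance, inferInstance, inferInstance, inferInstance, inferInstance, inferInstance, D,
    hD, 𝒟, hmax, hcni, hdrain, Θ, Ξ, fun s : ℝ ↦ Θ ⟨s • E4.basisVector 0, trivial⟩, δ, hΘ, hΞ, hΘΞ,
    hpinΘ, hfutΘ, hfloor, hδ, ?_, hray, ?_, hwild⟩
  · exact isFutureTimelikeCurveOn_axis 𝒟.toSpacetime Θ hΘ hpinΘ hfutΘ (Ici 0)
  · intro a ha
    refine ⟨E4.time (Ξ a) + 2 * ‖E4.spatial (Ξ a)‖ + 1, ?_,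
      axis_mem_chronologicalFuture 𝒟.toSpacetime Θ Ξ hΘ hΘΞ hpinΘ hfutΘ a⟩
    have h := hfloor a ha
    positivity

/-- **Negative lemma modulo `FramedAxisPulsesDevelopmentExists`** (axis form): one drained censored
maximal development of one admissible datum with a global near-Minkowski frame whose time axis is
ray-borne and recurrently `C²`-pulsed falsifies `DrainImpliesDisperse` as filed. [folklore] -/
theorem DrainImpliesDisperse_false_of_framedAxisPulsesDevelopmentExists
    (H : FramedAxisPulsesDevelopmentExists) : ¬ DrainImpliesDisperse :=
  DrainImpliesDisperse_false_of_framedPulsedObserverDevelopmentExists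
    (framedPulsedObserverDevelopmentExists_of_axis H)

end Summit.FinalStateConjecture.FinalStateConjecture.Theorems.DrainImpliesDisperse.Negative

end
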